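import Literature.NumberTheory.Automorphic.Liu2021.LemD1Item4AsPrintedIndexed
import Literature.NumberTheory.Automorphic.Liu2021.SplitPlaceOscillatorModelQuadExtPackage
import Literature.NumberTheory.Automorphic.PrincipalSeriesGL2WeylSymmetry
import Literature.NumberTheory.Automorphic.UnitaryGroupLocalLineHeckeTransport
import Literature.NumberTheory.GelbartRogawski1991.LocalSplittingCMGaloisTransport
import Literature.NumberTheory.GelbartRogawski1991.LocalUnitarySplittingsCM
import Literature.NumberTheory.GelbartRogawski1991.DoubledUnitaryGlobalSplittingData
import HarnessLib

/-!
# [Liu2021, Lem. D.1 (4)] at a SPLIT place, `n = 2`: two θ-package local factors with swapped split data are isomorphic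

Topic `NumberTheory/Automorphic/Liu2021`; namespace `Literature.NumberTheory.Automorphic.Liu2021.Def411WeilCarriers` (that of ★
`Def411WeilCarriersAtLine` ∕ ★ `LemD1Item4AsPrintedIndexed` §4).  KERNEL ONLY: theorems; no definition, no named fact, no `sorry`,
no instance, no notation.

[Liu2021] Y. Liu, *Fourier–Jacobi cycles and arithmetic relative trace formula*, Camb. J. Math. 9 (2021) = arXiv:2102.11518.  App. D,
Lemma D.1 (4) (l. 5235): «If `n = 2` and `ω(μ, ε, χ)` is nonzero, then `ω(μ', ε', χ')` is isomorphic to `ω(μ, ε, χ)` if and only if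
either `(μ', ε', χ') = (μ, ε, χ)`, or `μ' = μ^c χ̌`, `χ' = χ`, and …»; proof of Lemma D.1, first paragraph (p. 126, l. 5241): «We consider
first the case where `E = F × F`. We identify `U(V)` with `GL_n(F)` … and write `μ = ν ⊠ ν⁻¹` … Then `ω(μ, ε, χ)` is isomorphic to the
unitary induction from `Q_{n-1,1}(F)` to `GL_n(F)` of the (unitary) character `(ν∘det) ⊠ χν^{1-n}` … The lemma follows from such
description.»  At a SPLIT place and `n = 2` the two labels `μ`, `μ' = μ^c χ̌` have `w`-components `ν` and `ν⁻¹χ` (`μ^c = μ⁻¹` for a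
splitting character at a split place), so the two inductions are `i(ν ⊠ χν⁻¹)` and `i(χν⁻¹ ⊠ ν)` — the SAME inducing datum up to the Weyl
element: «the lemma follows» IS the Weyl symmetry of the irreducible unitary principal series of `GL₂` ([BernsteinZelevinsky1977, Thm. 2.9]),
★ `Zelevinsky1980.areIsomorphicRep_parabolicIndGL_two_swap` (`PrincipalSeriesGL2WeylSymmetry`).

THIS FILE proves the split-place half of item (4) for the tree's θ-PACKAGE LOCAL FACTORS (the currency of ★ `LemD1Item4AsPrintedIndexed` (r1)
`areIsomorphicRep_localType₂_iff_quot`, RHS), at the CM frame `(F, E, c, N, J_V) = (L⁺, L, c̄, 2, diag dV)`: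

* §1 bookkeeping on small terms: «isomorphic» of `χ`-coinvariant quotients along a propositional change of the acting representation
  (`areIsomorphicRep_twistedCoinv_rep_comp_congr`, `subst`), assembly along frames (`areIsomorphicRep_comp_of_frames`), unitary continuous
  characters `χ′ν⁻¹`, the exponent `1 - 2`;
* §2 `areIsomorphicRep_localFactor_comp_splitFrame_symm` — ONE package `𝓢` at the line `⟨a⟩` whose section at `v` is the CM section
  (`hs : 𝓢.s v = localSplittingCM … θ hθ v`; ★ `congrW_undoubledSplittings_cmFinLocalFamily_s` supplies it for the tree's θ-packages): the
  `χ_v`-coinvariants `Θ̃_v` of `𝓢.omegaLoc v`, pulled back along `e_w^{VW,-1}`, are `≅ i(θ_w ⊠ χ′θ_w^{1-2})` (★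
  `splitPlace_chiCoinv_iso_parabolicIndGL_localSplittingCM`, `ν = θ_w`, transported along `hs`);
* §3 **`areIsomorphicRep_localFactor_comp_localLineInl_of_split`** — TWO packages `𝓢₁, 𝓢₂` at lines `⟨a₁⟩, ⟨a₂⟩`, splitting characters
  `θ₁, θ₂`, central characters `χ₁, χ₂` with ONE `w`-reading `χ′`, and the LOCAL LABEL CLAUSE `θ₂_w = θ₁_w ∨ θ₂_w = χ′·θ₁_w⁻¹`:
  `Θ_v(2) ∘ localLineInl₂ ≅ Θ_v(1) ∘ localLineInl₁` as representations of `U(J_V)(L⁺_v)` — ANY two lines (line classes are vacuous at a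
  split place).  Proof: §2 twice, the frames `e_w^{VWᵢ}(k ⊗ 1) = reindexGL e (e_w^V k ⊗ 1)` (★ `localLineInl_localPiSplitEquiv_symm_apply`), and
  `i(θ₂_w ⊠ χ′θ₂_w⁻¹) ≅ i(θ₁_w ⊠ χ′θ₁_w⁻¹)`: `refl` in the first case, the Weyl symmetry ★ in the second.

Consumer: cell `hodgecm-mathlib`, crux `HLiu418` (item `stmt-HodgeConjecture-24832`), P5 pay-down line
`Cruxes/HLiu418/Lines/F0_P5_CurveThetaLettersPaydown.lean` (R2′ ∕ R2″: the split-place `hiso` of the route-P assembly; the companion member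
`θ₂ = θ₁ᶜ·χ̌` satisfies the right disjunct by ★ `CheckOfChi.localMu_galConj_mul_checkOfChi_apply` read at `w`).  HC_CM is NOT proved by
anything here.

## References
* [Liu2021] Y. Liu, Camb. J. Math. 9 (2021): App. D §D.1, Lemma D.1 (2), (4), proof of Lemma D.1 (first paragraph) p. 126.
* [GelbartRogawski1991] S. Gelbart, J. Rogawski, Invent. Math. 105 (1991), §3.1 Prop. 3.1.1 p. 455; §3.2 p. 457.
* [BernsteinZelevinsky1977] I. N. Bernstein, A. V. Zelevinsky, Ann. Sci. ÉNS 10 (1977), Thm. 2.9.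
* [MoeglinVignerasWaldspurger1987] C. Mœglin, M.-F. Vignéras, J.-L. Waldspurger, LNM 1291 (1987), Chap. 3 §III.7 a).
-/

set_option autoImplicit false

noncomputable section

open scoped Matrix Kronecker
open NumberField IsDedekindDomain
open Literature.NumberTheory Literature.NumberTheory.Automorphic Literature.NumberTheory.Automorphic.UnitaryGroup
open Literature.NumberTheory.GelbartRogawski1991 Literature.NumberTheory.GelbartRogawski1991.UnitaryDualPair
open Literature.NumberTheory.GelbartRogawski1991.UnitaryDualPair.WeilCoinv
open Literature.NumberTheory.GelbartRogawski1991.UnitaryDualPair.LocalSplitting (localSplittingCM localSchrodinger)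
open Literature.RepresentationTheory.HeisenbergGroup (MpPsi)
open Literature.NumberTheory.GelbartRogawski1991.GRConstruction
open Literature.NumberTheory.Weil1964 Literature.RepresentationTheory
open Literature.NumberTheory.GaloisRepresentations Literature.RepresentationTheory.HarrisKudlaSweet1996
open Literature.NumberTheory.Automorphic.Zelevinsky1980 (lastBlockLabel maxParabolicLeviChar)

namespace Literature.NumberTheory.Automorphic.Liu2021.Def411WeilCarriers

/-! ## §1 Bookkeeping: transport of «isomorphic»; unitary continuous characters -/

section Generic

/-- **«isomorphic» of `χ`-coinvariant quotients does not see a propositional change of the acting representation**: for `ρ = ρ'`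
the representations on the `χ`-coinvariants (★ `TwistedCoinv.rep`), pulled back along any `φ`, are isomorphic (`subst`; used to
replace a θ-package section `𝓢.s v` by the CM section `localSplittingCM … v` it equals). [cite: Liu2021, App. D §D.1 Step 3 (l. 5221)] -/
theorem areIsomorphicRep_twistedCoinv_rep_comp_congr {G H K V : Type*} [Group G] [Group H] [Group K] [AddCommGroup V] [Module ℂ V]
    {ρ ρ' : Representation ℂ G V} (hρ : ρ = ρ') (ι : H →* G) (χ : H →* ℂˣ)
    (hc : ∀ (g : G) (h : H), Commute (ρ g) ((show Representation ℂ H V from ρ.comp ι) h))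
    (hc' : ∀ (g : G) (h : H), Commute (ρ' g) ((show Representation ℂ H V from ρ'.comp ι) h)) (φ : K →* G) :
    AreIsomorphicRep ((TwistedCoinv.rep (ρW := show Representation ℂ H V from ρ.comp ι) χ ρ hc).comp φ)
      ((TwistedCoinv.rep (ρW := show Representation ℂ H V from ρ'.comp ι) χ ρ' hc').comp φ) := by
  subst hρ
  exact AreIsomorphicRep.refl _

/-- the product of a unitary character with the inverse of a unitary character is unitary. [folklore] -/
private theorem norm_mul_inv_apply_eq_one {M : Type*} [Monoid M] (ν χ' : M →* ℂˣ) (hνu : ∀ x, ‖((ν x : ℂˣ) : ℂ)‖ = 1)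
    (hχ'u : ∀ x, ‖((χ' x : ℂˣ) : ℂ)‖ = 1) (x : M) : ‖(((χ' * ν⁻¹) x : ℂˣ) : ℂ)‖ = 1 := by
  rw [MonoidHom.mul_apply, MonoidHom.inv_apply, Units.val_mul, Units.val_inv_eq_inv_val, norm_mul, norm_inv, hνu, hχ'u,
    inv_one, mul_one]

/-- the product of a continuous character with the inverse of a continuous character is continuous. [folklore] -/
private theorem continuous_mul_inv_apply {M : Type*} [Monoid M] [TopologicalSpace M] (ν χ' : M →* ℂˣ)
    (hνc : Continuous fun x => ((ν x : ℂˣ) : ℂ)) (hχ'c : Continuous fun x => ((χ' x : ℂˣ) : ℂ)) :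
    Continuous fun x => (((χ' * ν⁻¹) x : ℂˣ) : ℂ) := by
  have h : (fun x => (((χ' * ν⁻¹) x : ℂˣ) : ℂ)) = fun x => ((χ' x : ℂˣ) : ℂ) * (((ν x : ℂˣ) : ℂ))⁻¹ := by
    funext x
    rw [MonoidHom.mul_apply, MonoidHom.inv_apply, Units.val_mul, Units.val_inv_eq_inv_val]
  rw [h]
  exact hχ'c.mul (hνc.inv₀ fun x => (ν x).ne_zero)

/-- `ψ^{1-2} = ψ⁻¹` for characters (the exponent of the split-place model at `N = 2`). [folklore] -/
private theorem zpow_one_sub_two_eq_inv {M : Type*} [Monoid M] (ψ : M →* ℂˣ) : ψ ^ (1 - ((2 : ℕ) : ℤ)) = ψ⁻¹ := by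
  rw [show (1 - ((2 : ℕ) : ℤ)) = -1 by norm_num]
  exact zpow_neg_one ψ

/-- `χ' · (χ' · ν⁻¹)^{1-2} = ν` (the second inducing character of the swapped datum). [folklore] -/
private theorem mul_mul_inv_zpow_one_sub_two {M : Type*} [Monoid M] (ν χ' : M →* ℂˣ) :
    χ' * (χ' * ν⁻¹) ^ (1 - ((2 : ℕ) : ℤ)) = ν := by
  rw [zpow_one_sub_two_eq_inv]
  ext x
  rw [MonoidHom.mul_apply, MonoidHom.inv_apply, MonoidHom.mul_apply, MonoidHom.inv_apply, mul_inv_rev, inv_inv,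
    mul_comm (ν x), ← mul_assoc, mul_inv_cancel, one_mul]

/-- `χ' · ν^{1-2} = χ' · ν⁻¹`. [folklore] -/
private theorem mul_zpow_one_sub_two {M : Type*} [Monoid M] (ν χ' : M →* ℂˣ) : χ' * ν ^ (1 - ((2 : ℕ) : ℤ)) = χ' * ν⁻¹ := by
  rw [zpow_one_sub_two_eq_inv]

/-- **assembly along frames** (bookkeeping for the split place): if `inlᵢ = φᵢ ∘ ψ` pointwise, `ρᵢ ∘ φᵢ ≅ πᵢ` and `π₂ ≅ π₁`, then
`ρ₂ ∘ inl₂ ≅ ρ₁ ∘ inl₁`. [cite: GelbartRogawski1991, §3.2 p. 457] -/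
theorem areIsomorphicRep_comp_of_frames {G G₁ G₂ K : Type*} [Group G] [Group G₁] [Group G₂] [Group K]
    {V₁ V₂ W₁ W₂ : Type*} [AddCommGroup V₁] [Module ℂ V₁] [AddCommGroup V₂] [Module ℂ V₂] [AddCommGroup W₁] [Module ℂ W₁]
    [AddCommGroup W₂] [Module ℂ W₂] {ρ₁ : Representation ℂ G₁ V₁} {ρ₂ : Representation ℂ G₂ V₂}
    {π₁ : Representation ℂ K W₁} {π₂ : Representation ℂ K W₂}
    (inl₁ : G →* G₁) (inl₂ : G →* G₂) (φ₁ : K →* G₁) (φ₂ : K →* G₂) (ψ : G → K)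
    (hk₁ : ∀ k, inl₁ k = φ₁ (ψ k)) (hk₂ : ∀ k, inl₂ k = φ₂ (ψ k))
    (h₁ : AreIsomorphicRep (ρ₁.comp φ₁) π₁) (h₂ : AreIsomorphicRep (ρ₂.comp φ₂) π₂) (hπ : AreIsomorphicRep π₂ π₁) :
    AreIsomorphicRep (ρ₂.comp inl₂) (ρ₁.comp inl₁) := by
  obtain ⟨f₁, hf₁⟩ := h₁
  obtain ⟨f₂, hf₂⟩ := h₂
  obtain ⟨P, hP⟩ := hπ
  refine ⟨f₂.trans (P.trans f₁.symm), fun k x => ?_⟩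
  simp only [LinearEquiv.trans_apply]
  rw [MonoidHom.comp_apply, MonoidHom.comp_apply, hk₁, hk₂]
  have e₂ := hf₂ (ψ k) x
  have e₁ := hf₁ (ψ k) (f₁.symm (P (f₂ x)))
  rw [MonoidHom.comp_apply] at e₁ e₂
  rw [LinearEquiv.apply_symm_apply] at e₁
  rw [e₂, hP, ← e₁, LinearEquiv.symm_apply_apply]

end Generic


/-! ## §2 One θ-package at a split place: its local factor, pulled back along the split frame, is a principal series -/

set_option maxHeartbeats 3000000 in -- the explicit split model ★ `splitPlace_chiCoinv_iso_parabolicIndGL_localSplittingCM` (2 M itself) + transport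
/-- **ONE θ-PACKAGE AT A SPLIT PLACE.** For the CM frame `(L, e, dV)` (`J_V = diag dV` hermitian, rank `2`), a line `⟨a⟩`, a central
character `χ ∈ Chi` with `w`-reading `χ′`, a unitary splitting character `θ` and a package `𝓢` of local splittings at `J_{VW} =
reindex e (J_V ⊗ (a))` WHOSE SECTION AT `v` IS THE CM SECTION (`hs : 𝓢.s v = localSplittingCM … θ hθ v`), at a place `v` of `L⁺` split in
`L` (`w ∣ v`, `c̄ • w ≠ w`): the `χ_v`-coinvariants `Θ̃_v` of `𝓢.omegaLoc v` under the centre, pulled back along `e_w^{VW,-1} : GL₂(L_w) ≃ U(J_{VW})(L⁺_v)`,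
are isomorphic to the principal series `i(θ_w ⊠ χ′θ_w^{1-2})` of `GL₂(L_w)`; and `θ_w`, `χ′` are unitary continuous.  (★
`splitPlace_chiCoinv_iso_parabolicIndGL_localSplittingCM` — `ν = θ_w` — transported from the CM section to `𝓢` along `hs`.)
[cite: Liu2021, App. D, proof of Lemma D.1 (first paragraph), p. 126] [cite: GelbartRogawski1991, §3.1 Prop. 3.1.1 p. 455] -/
theorem areIsomorphicRep_localFactor_comp_splitFrame_symm
    (L : Type) [Field L] [NumberField L] [IsCMField L] (hc1 : IsCMField.complexConj L ≠ 1)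
    (e : Fin 2 × Fin 1 ≃ Fin 2)
    (dV : Fin 2 → L) (hdV : ∀ i, IsCMField.complexConj L (dV i) = dV i) (hdV0 : ∀ i, dV i ≠ 0)
    (a : (Fp L)ˣ) (χ : Chi (Fp L) L (IsCMField.complexConj L))
    (𝓢 : LocalSplitting.FinLocalSplittings (Fp L) L (IsCMField.complexConj L) 2 (complexConj_imagUnit L) (imagUnit_ne_zero L) (imagUnit_mul_self L) (gram (Fp L) e (realDiagonal L dV hdV) (TW (Fp L) a))
      (isSymm_gram (Fp L) e (realDiagonal_isSymm L dV hdV) (isSymm_TW (Fp L) a))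
      (reindex_kronecker_eq_gram_map (Fp L) L e (realDiagonal_map L dV hdV).symm (JW_eq (Fp L) L a)))
    (θ : HeckeCharacter L) (hθ : IsSplittingChar L 1 θ) (hθu : θ.IsUnitary)
    (v : HeightOneSpectrum (𝓞 (Fp L))) (w : UnitaryGroup.PlacesOver L v)
    (hw : IsCMField.complexConj L • (w : HeightOneSpectrum (𝓞 L)) ≠ w)
    (hs : (𝓢).s v = localSplittingCM L 2 (T₀ := gram (Fp L) e (realDiagonal L dV hdV) (TW (Fp L) a))
        (isSymm_gram (Fp L) e (realDiagonal_isSymm L dV hdV) (isSymm_TW (Fp L) a))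
        (isUnit_det_gram (Fp L) e (isUnit_det_realDiagonal L dV hdV hdV0) (isUnit_det_TW (Fp L) a))
        (reindex_kronecker_eq_gram_map (Fp L) L e (realDiagonal_map L dV hdV).symm (JW_eq (Fp L) L a)) θ hθ v)
    (hJh : (((Matrix.reindex e e ((Matrix.diagonal dV) ⊗ₖ JW (Fp L) L a))).map (IsCMField.complexConj L))ᵀ = (Matrix.reindex e e ((Matrix.diagonal dV) ⊗ₖ JW (Fp L) L a)))
    (hJw : IsUnit (UnitaryGroup.placeForm (Matrix.reindex e e ((Matrix.diagonal dV) ⊗ₖ JW (Fp L) L a)) (w : HeightOneSpectrum (𝓞 L))))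
    [LocallyCompactSpace (standardParabolicGL ((w : HeightOneSpectrum (𝓞 L)).adicCompletion L) (lastBlockLabel 2))]
    (χ' : (((w : HeightOneSpectrum (𝓞 L)).adicCompletion L))ˣ →* ℂˣ)
    (hχ' : ∀ z : UnitaryGroup.localPi L (IsCMField.complexConj L) 1 (JW (Fp L) L a) v,
        χ' (Matrix.GeneralLinearGroup.det ((z : UnitaryGroup.LocalGLPi L 1 v) w)) =
          localCharOfCenter (Fp L) L (IsCMField.complexConj L) (JW (Fp L) L a) (JW_apply_ne_zero (Fp L) L a) (χ).1 v z) :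
    ((∀ x, ‖(((θ.localComponent (w : HeightOneSpectrum (𝓞 L))) x : ℂˣ) : ℂ)‖ = 1) ∧
        (Continuous fun x => (((θ.localComponent (w : HeightOneSpectrum (𝓞 L))) x : ℂˣ) : ℂ)) ∧
      (∀ x, ‖((χ' x : ℂˣ) : ℂ)‖ = 1) ∧ (Continuous fun x => ((χ' x : ℂˣ) : ℂ))) ∧
    AreIsomorphicRep
      ((show Representation ℂ (UnitaryGroup.localPi L (IsCMField.complexConj L) 2 (Matrix.reindex e e ((Matrix.diagonal dV) ⊗ₖ JW (Fp L) L a)) v) _ from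
        (TwistedCoinv.rep (localCharOfCenter (Fp L) L (IsCMField.complexConj L) (JW (Fp L) L a) (JW_apply_ne_zero (Fp L) L a) (χ).1 v) ((𝓢).omegaLoc v)
          (commute_omegaLoc_localCenter (Fp L) L (IsCMField.complexConj L) 2 e (Matrix.diagonal dV) (JW (Fp L) L a) (complexConj_imagUnit L) (imagUnit_ne_zero L) (imagUnit_mul_self L) (realDiagonal_isSymm L dV hdV) (isSymm_TW (Fp L) a) (realDiagonal_map L dV hdV).symm
            (JW_eq (Fp L) L a) (JW_apply_ne_zero (Fp L) L a) 𝓢 v))).comp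
        (UnitaryGroup.localPiSplitEquiv (IsCMField.complexConj L) (Matrix.reindex e e ((Matrix.diagonal dV) ⊗ₖ JW (Fp L) L a)) hc1 hJh w hw hJw).symm.toMonoidHom)
      (Representation.parabolicIndGL ((w : HeightOneSpectrum (𝓞 L)).adicCompletion L) (lastBlockLabel 2) ((Representation.trivial ℂ (Π b : Bool, GL {i : Fin 2 // lastBlockLabel 2 i = b} ((w : HeightOneSpectrum (𝓞 L)).adicCompletion L)) ℂ).twist (maxParabolicLeviChar ((w : HeightOneSpectrum (𝓞 L)).adicCompletion L) 2 (θ.localComponent (w : HeightOneSpectrum (𝓞 L))) (χ' * (θ.localComponent (w : HeightOneSpectrum (𝓞 L))) ^ (1 - ((2 : ℕ) : ℤ)))))) := by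
  classical
  obtain ⟨t, hT⟩ : ∃ t, (gram (Fp L) e (realDiagonal L dV hdV) (TW (Fp L) a)) = Matrix.diagonal t :=
    ⟨_, by unfold realDiagonal; exact LocalSplitting.gram_diagonal_TW e _ a⟩
  have hχu : ∀ z, ‖(((localCharOfCenter (Fp L) L (IsCMField.complexConj L) (JW (Fp L) L a) (JW_apply_ne_zero (Fp L) L a) (χ).1 v) z : ℂˣ) : ℂ)‖ = 1 := fun z =>
    norm_localCharOfCenter (Fp L) L (IsCMField.complexConj L) (JW (Fp L) L a) (JW_apply_ne_zero (Fp L) L a) (norm_chi_eq_one_cm L χ) v z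
  have hχc : Continuous fun z => (((localCharOfCenter (Fp L) L (IsCMField.complexConj L) (JW (Fp L) L a) (JW_apply_ne_zero (Fp L) L a) (χ).1 v) z : ℂˣ) : ℂ) :=
    continuous_coe_localCharOfCenter (Fp L) L (IsCMField.complexConj L) (JW (Fp L) L a) (JW_apply_ne_zero (Fp L) L a) χ.2.1 v
  obtain ⟨hu, M⟩ := splitPlace_chiCoinv_iso_parabolicIndGL_localSplittingCM L hc1 2 le_rfl
    (gram (Fp L) e (realDiagonal L dV hdV) (TW (Fp L) a)) (isSymm_gram (Fp L) e (realDiagonal_isSymm L dV hdV) (isSymm_TW (Fp L) a)) (isUnit_det_gram (Fp L) e (isUnit_det_realDiagonal L dV hdV hdV0) (isUnit_det_TW (Fp L) a)) t hT (Matrix.reindex e e ((Matrix.diagonal dV) ⊗ₖ JW (Fp L) L a)) (reindex_kronecker_eq_gram_map (Fp L) L e (realDiagonal_map L dV hdV).symm (JW_eq (Fp L) L a)) hJh v w hw hJw θ hθ hθu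
    (JW (Fp L) L a) (JW_apply_ne_zero (Fp L) L a) (localCharOfCenter (Fp L) L (IsCMField.complexConj L) (JW (Fp L) L a) (JW_apply_ne_zero (Fp L) L a) (χ).1 v) hχu hχc χ' hχ'
  refine ⟨hu, ?_⟩
  have hω : 𝓢.omegaLoc v = ((MpPsi.toRep (localSchrodinger (Fp L) 2 (gram (Fp L) e (realDiagonal L dV hdV) (TW (Fp L) a)) v)).comp (localSplittingCM L 2 (isSymm_gram (Fp L) e (realDiagonal_isSymm L dV hdV) (isSymm_TW (Fp L) a)) (isUnit_det_gram (Fp L) e (isUnit_det_realDiagonal L dV hdV hdV0) (isUnit_det_TW (Fp L) a)) (reindex_kronecker_eq_gram_map (Fp L) L e (realDiagonal_map L dV hdV).symm (JW_eq (Fp L) L a)) θ hθ v)) := by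
    rw [LocalSplitting.FinLocalSplittings.omegaLoc, hs]
  exact (areIsomorphicRep_twistedCoinv_rep_comp_congr hω
    (UnitaryGroup.localCenter L (IsCMField.complexConj L) 2 (Matrix.reindex e e ((Matrix.diagonal dV) ⊗ₖ JW (Fp L) L a)) (JW (Fp L) L a) (JW_apply_ne_zero (Fp L) L a) v)
    (localCharOfCenter (Fp L) L (IsCMField.complexConj L) (JW (Fp L) L a) (JW_apply_ne_zero (Fp L) L a) (χ).1 v)
    (commute_omegaLoc_localCenter (Fp L) L (IsCMField.complexConj L) 2 e (Matrix.diagonal dV) (JW (Fp L) L a) (complexConj_imagUnit L) (imagUnit_ne_zero L) (imagUnit_mul_self L) (realDiagonal_isSymm L dV hdV) (isSymm_TW (Fp L) a) (realDiagonal_map L dV hdV).symm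
      (JW_eq (Fp L) L a) (JW_apply_ne_zero (Fp L) L a) 𝓢 v)
    (fun g z => (show Commute g (UnitaryGroup.localCenter L (IsCMField.complexConj L) 2 (Matrix.reindex e e ((Matrix.diagonal dV) ⊗ₖ JW (Fp L) L a)) (JW (Fp L) L a) (JW_apply_ne_zero (Fp L) L a) v z) from
      UnitaryGroup.localCenter_comm L (IsCMField.complexConj L) 2 (Matrix.reindex e e ((Matrix.diagonal dV) ⊗ₖ JW (Fp L) L a)) (JW (Fp L) L a) (JW_apply_ne_zero (Fp L) L a) v z g).map _)
    (UnitaryGroup.localPiSplitEquiv (IsCMField.complexConj L) (Matrix.reindex e e ((Matrix.diagonal dV) ⊗ₖ JW (Fp L) L a)) hc1 hJh w hw hJw).symm.toMonoidHom).trans M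

/-! ## §3 The split place: two θ-package local factors with swapped split data are isomorphic -/


set_option maxHeartbeats 3000000 in -- two §2 instances (the explicit split model ★ elaborates at 2 M) + the frames; measured (1.6 M, 3 M]
/-- **[Liu2021, Lem. D.1 (4)] AT A SPLIT PLACE, `n = 2`, FOR THE θ-PACKAGE LOCAL FACTORS.**  Data: the CM frame `(L, e, dV)` (`J_V = diag dV`,
rank `2`), two lines `⟨a₁⟩, ⟨a₂⟩`, two central characters `χ₁, χ₂ ∈ Chi` with a COMMON `w`-reading `χ′` (`hχ'ᵢ`), two unitary splitting
characters `θ₁, θ₂`, two packages `𝓢ᵢ` of local splittings at `J_{VWᵢ} = reindex e (diag dV ⊗ (aᵢ))` whose sections at `v` are the CM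
sections (`hsᵢ`), a place `v` of `L⁺` SPLIT in `L` (`w ∣ v`, `c̄ • w ≠ w`), and the LOCAL LABEL CLAUSE `hθw : θ₂_w = θ₁_w ∨ θ₂_w = χ′·θ₁_w⁻¹`
(for the companion label `θ₂ = θ₁ᶜ·χ̌` of item (4): the right disjunct, «`μ′ = μᶜχ̌`» read at `w`).  Conclusion: the local factors
`Θ_v(i) ∘ localLineInlᵢ = (χ_{i,v}-coinvariants of 𝓢ᵢ.omegaLoc v under the centre) ∘ (k ↦ k ⊗ 1)` — the RHS currency of ★ (r1)
`areIsomorphicRep_localType₂_iff_quot` — satisfy `Θ_v(2) ∘ localLineInl₂ ≅ Θ_v(1) ∘ localLineInl₁` (`AreIsomorphicRep`, representations of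
`U(J_V)(L⁺_v)`), for ANY `a₁, a₂`.  Proof: §2 twice + the frames + `refl` ∕ ★ `Zelevinsky1980.areIsomorphicRep_parabolicIndGL_two_swap`.
[cite: Liu2021, App. D Lemma D.1 (4) (l. 5235) and proof of Lemma D.1 (first paragraph), p. 126] [cite: BernsteinZelevinsky1977, Thm. 2.9]
[cite: GelbartRogawski1991, §3.2 p. 457] -/
theorem areIsomorphicRep_localFactor_comp_localLineInl_of_split
    (L : Type) [Field L] [NumberField L] [IsCMField L] (hc1 : IsCMField.complexConj L ≠ 1)
    {n' : ℕ} (e : Fin 2 × Fin 1 ≃ Fin n')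
    (dV : Fin 2 → L) (hdV : ∀ i, IsCMField.complexConj L (dV i) = dV i) (hdV0 : ∀ i, dV i ≠ 0)
    (a₁ a₂ : (Fp L)ˣ) (χ₁ χ₂ : Chi (Fp L) L (IsCMField.complexConj L))
    (𝓢₁ : LocalSplitting.FinLocalSplittings (Fp L) L (IsCMField.complexConj L) n' (complexConj_imagUnit L) (imagUnit_ne_zero L) (imagUnit_mul_self L) (gram (Fp L) e (realDiagonal L dV hdV) (TW (Fp L) a₁))
      (isSymm_gram (Fp L) e (realDiagonal_isSymm L dV hdV) (isSymm_TW (Fp L) a₁))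
      (reindex_kronecker_eq_gram_map (Fp L) L e (realDiagonal_map L dV hdV).symm (JW_eq (Fp L) L a₁)))
    (𝓢₂ : LocalSplitting.FinLocalSplittings (Fp L) L (IsCMField.complexConj L) n' (complexConj_imagUnit L) (imagUnit_ne_zero L) (imagUnit_mul_self L) (gram (Fp L) e (realDiagonal L dV hdV) (TW (Fp L) a₂))
      (isSymm_gram (Fp L) e (realDiagonal_isSymm L dV hdV) (isSymm_TW (Fp L) a₂))
      (reindex_kronecker_eq_gram_map (Fp L) L e (realDiagonal_map L dV hdV).symm (JW_eq (Fp L) L a₂)))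
    (θ₁ θ₂ : HeckeCharacter L) (hθ₁ : IsSplittingChar L 1 θ₁) (hθ₂ : IsSplittingChar L 1 θ₂)
    (hθ₁u : θ₁.IsUnitary) (hθ₂u : θ₂.IsUnitary)
    (v : HeightOneSpectrum (𝓞 (Fp L))) (w : UnitaryGroup.PlacesOver L v)
    (hw : IsCMField.complexConj L • (w : HeightOneSpectrum (𝓞 L)) ≠ w)
    (hs₁ : (𝓢₁).s v = localSplittingCM L n' (T₀ := gram (Fp L) e (realDiagonal L dV hdV) (TW (Fp L) a₁))
        (isSymm_gram (Fp L) e (realDiagonal_isSymm L dV hdV) (isSymm_TW (Fp L) a₁))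
        (isUnit_det_gram (Fp L) e (isUnit_det_realDiagonal L dV hdV hdV0) (isUnit_det_TW (Fp L) a₁))
        (reindex_kronecker_eq_gram_map (Fp L) L e (realDiagonal_map L dV hdV).symm (JW_eq (Fp L) L a₁)) θ₁ hθ₁ v)
    (hs₂ : (𝓢₂).s v = localSplittingCM L n' (T₀ := gram (Fp L) e (realDiagonal L dV hdV) (TW (Fp L) a₂))
        (isSymm_gram (Fp L) e (realDiagonal_isSymm L dV hdV) (isSymm_TW (Fp L) a₂))
        (isUnit_det_gram (Fp L) e (isUnit_det_realDiagonal L dV hdV hdV0) (isUnit_det_TW (Fp L) a₂))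
        (reindex_kronecker_eq_gram_map (Fp L) L e (realDiagonal_map L dV hdV).symm (JW_eq (Fp L) L a₂)) θ₂ hθ₂ v)
    [LocallyCompactSpace (standardParabolicGL ((w : HeightOneSpectrum (𝓞 L)).adicCompletion L) (lastBlockLabel n'))]
    (χ' : (((w : HeightOneSpectrum (𝓞 L)).adicCompletion L))ˣ →* ℂˣ)
    (hχ'₁ : ∀ z : UnitaryGroup.localPi L (IsCMField.complexConj L) 1 (JW (Fp L) L a₁) v,
        χ' (Matrix.GeneralLinearGroup.det ((z : UnitaryGroup.LocalGLPi L 1 v) w)) =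
          localCharOfCenter (Fp L) L (IsCMField.complexConj L) (JW (Fp L) L a₁) (JW_apply_ne_zero (Fp L) L a₁) (χ₁).1 v z)
    (hχ'₂ : ∀ z : UnitaryGroup.localPi L (IsCMField.complexConj L) 1 (JW (Fp L) L a₂) v,
        χ' (Matrix.GeneralLinearGroup.det ((z : UnitaryGroup.LocalGLPi L 1 v) w)) =
          localCharOfCenter (Fp L) L (IsCMField.complexConj L) (JW (Fp L) L a₂) (JW_apply_ne_zero (Fp L) L a₂) (χ₂).1 v z)
    (hθw : θ₂.localComponent (w : HeightOneSpectrum (𝓞 L)) = θ₁.localComponent (w : HeightOneSpectrum (𝓞 L)) ∨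
      θ₂.localComponent (w : HeightOneSpectrum (𝓞 L)) = χ' * (θ₁.localComponent (w : HeightOneSpectrum (𝓞 L)))⁻¹) :
    AreIsomorphicRep
      (show Representation ℂ (UnitaryGroup.localPi L (IsCMField.complexConj L) 2 (Matrix.diagonal dV) v) _ from
        (TwistedCoinv.rep (localCharOfCenter (Fp L) L (IsCMField.complexConj L) (JW (Fp L) L a₂) (JW_apply_ne_zero (Fp L) L a₂) (χ₂).1 v) ((𝓢₂).omegaLoc v)
          (commute_omegaLoc_localCenter (Fp L) L (IsCMField.complexConj L) 2 e (Matrix.diagonal dV) (JW (Fp L) L a₂) (complexConj_imagUnit L) (imagUnit_ne_zero L) (imagUnit_mul_self L) (realDiagonal_isSymm L dV hdV) (isSymm_TW (Fp L) a₂) (realDiagonal_map L dV hdV).symm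
            (JW_eq (Fp L) L a₂) (JW_apply_ne_zero (Fp L) L a₂) 𝓢₂ v)).comp (UnitaryGroup.localLineInl L (IsCMField.complexConj L) 2 e (Matrix.diagonal dV) (JW (Fp L) L a₂) v))
      (show Representation ℂ (UnitaryGroup.localPi L (IsCMField.complexConj L) 2 (Matrix.diagonal dV) v) _ from
        (TwistedCoinv.rep (localCharOfCenter (Fp L) L (IsCMField.complexConj L) (JW (Fp L) L a₁) (JW_apply_ne_zero (Fp L) L a₁) (χ₁).1 v) ((𝓢₁).omegaLoc v)
          (commute_omegaLoc_localCenter (Fp L) L (IsCMField.complexConj L) 2 e (Matrix.diagonal dV) (JW (Fp L) L a₁) (complexConj_imagUnit L) (imagUnit_ne_zero L) (imagUnit_mul_self L) (realDiagonal_isSymm L dV hdV) (isSymm_TW (Fp L) a₁) (realDiagonal_map L dV hdV).symm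
            (JW_eq (Fp L) L a₁) (JW_apply_ne_zero (Fp L) L a₁) 𝓢₁ v)).comp (UnitaryGroup.localLineInl L (IsCMField.complexConj L) 2 e (Matrix.diagonal dV) (JW (Fp L) L a₁) v)) := by
  classical
  -- `n' = 2`
  obtain rfl : n' = 2 := by
    have h := Fintype.card_congr e
    simp only [Fintype.card_prod, Fintype.card_fin] at h
    omega
  -- side conditions at `J_V` and the two `J_{VWᵢ}`
  have hJh₁ : (((Matrix.reindex e e ((Matrix.diagonal dV) ⊗ₖ JW (Fp L) L a₁))).map (IsCMField.complexConj L))ᵀ = (Matrix.reindex e e ((Matrix.diagonal dV) ⊗ₖ JW (Fp L) L a₁)) := transpose_map_conj_JV (Fp L) L (IsCMField.complexConj L) 2 _ (isSymm_gram (Fp L) e (realDiagonal_isSymm L dV hdV) (isSymm_TW (Fp L) a₁)) (reindex_kronecker_eq_gram_map (Fp L) L e (realDiagonal_map L dV hdV).symm (JW_eq (Fp L) L a₁))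
  have hJh₂ : (((Matrix.reindex e e ((Matrix.diagonal dV) ⊗ₖ JW (Fp L) L a₂))).map (IsCMField.complexConj L))ᵀ = (Matrix.reindex e e ((Matrix.diagonal dV) ⊗ₖ JW (Fp L) L a₂)) := transpose_map_conj_JV (Fp L) L (IsCMField.complexConj L) 2 _ (isSymm_gram (Fp L) e (realDiagonal_isSymm L dV hdV) (isSymm_TW (Fp L) a₂)) (reindex_kronecker_eq_gram_map (Fp L) L e (realDiagonal_map L dV hdV).symm (JW_eq (Fp L) L a₂))
  have hJVh : (((Matrix.diagonal dV)).map (IsCMField.complexConj L))ᵀ = (Matrix.diagonal dV) := transpose_map_conj_JV (Fp L) L (IsCMField.complexConj L) 2 _ (realDiagonal_isSymm L dV hdV) (realDiagonal_map L dV hdV).symm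
  have hJw₁ : IsUnit (UnitaryGroup.placeForm (Matrix.reindex e e ((Matrix.diagonal dV) ⊗ₖ JW (Fp L) L a₁)) (w : HeightOneSpectrum (𝓞 L))) :=
    UnitaryGroup.isUnit_placeForm _ ((Matrix.isUnit_iff_isUnit_det _).2
      (isUnit_iff_ne_zero.2 (det_JV_ne_zero (Fp L) L 2 _ (isUnit_det_gram (Fp L) e (isUnit_det_realDiagonal L dV hdV hdV0) (isUnit_det_TW (Fp L) a₁)) (reindex_kronecker_eq_gram_map (Fp L) L e (realDiagonal_map L dV hdV).symm (JW_eq (Fp L) L a₁))))) _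
  have hJw₂ : IsUnit (UnitaryGroup.placeForm (Matrix.reindex e e ((Matrix.diagonal dV) ⊗ₖ JW (Fp L) L a₂)) (w : HeightOneSpectrum (𝓞 L))) :=
    UnitaryGroup.isUnit_placeForm _ ((Matrix.isUnit_iff_isUnit_det _).2
      (isUnit_iff_ne_zero.2 (det_JV_ne_zero (Fp L) L 2 _ (isUnit_det_gram (Fp L) e (isUnit_det_realDiagonal L dV hdV hdV0) (isUnit_det_TW (Fp L) a₂)) (reindex_kronecker_eq_gram_map (Fp L) L e (realDiagonal_map L dV hdV).symm (JW_eq (Fp L) L a₂))))) _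
  have hJVw : IsUnit (UnitaryGroup.placeForm (Matrix.diagonal dV) (w : HeightOneSpectrum (𝓞 L))) :=
    UnitaryGroup.isUnit_placeForm _ ((Matrix.isUnit_iff_isUnit_det _).2
      (isUnit_iff_ne_zero.2 (det_JV_ne_zero (Fp L) L 2 _ (isUnit_det_realDiagonal L dV hdV hdV0) (realDiagonal_map L dV hdV).symm))) _
  -- the two split models (§2)
  obtain ⟨⟨hθ₁wu, hθ₁wc, hχ'u, hχ'c⟩, N₁⟩ := areIsomorphicRep_localFactor_comp_splitFrame_symm L hc1 e dV hdV hdV0 a₁ χ₁ 𝓢₁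
    θ₁ hθ₁ hθ₁u v w hw hs₁ hJh₁ hJw₁ χ' hχ'₁
  obtain ⟨-, N₂⟩ := areIsomorphicRep_localFactor_comp_splitFrame_symm L hc1 e dV hdV hdV0 a₂ χ₂ 𝓢₂
    θ₂ hθ₂ hθ₂u v w hw hs₂ hJh₂ hJw₂ χ' hχ'₂
  -- the two principal series of `GL₂(L_w)` are isomorphic (refl ∕ the Weyl symmetry ★ `areIsomorphicRep_parabolicIndGL_two_swap`)
  have hPS : AreIsomorphicRep
      (Representation.parabolicIndGL ((w : HeightOneSpectrum (𝓞 L)).adicCompletion L) (lastBlockLabel 2) ((Representation.trivial ℂ (Π b : Bool, GL {i : Fin 2 // lastBlockLabel 2 i = b} ((w : HeightOneSpectrum (𝓞 L)).adicCompletion L)) ℂ).twist (maxParabolicLeviChar ((w : HeightOneSpectrum (𝓞 L)).adicCompletion L) 2 (θ₂.localComponent (w : HeightOneSpectrum (𝓞 L))) (χ' * (θ₂.localComponent (w : HeightOneSpectrum (𝓞 L))) ^ (1 - ((2 : ℕ) : ℤ))))))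
      (Representation.parabolicIndGL ((w : HeightOneSpectrum (𝓞 L)).adicCompletion L) (lastBlockLabel 2) ((Representation.trivial ℂ (Π b : Bool, GL {i : Fin 2 // lastBlockLabel 2 i = b} ((w : HeightOneSpectrum (𝓞 L)).adicCompletion L)) ℂ).twist (maxParabolicLeviChar ((w : HeightOneSpectrum (𝓞 L)).adicCompletion L) 2 (θ₁.localComponent (w : HeightOneSpectrum (𝓞 L))) (χ' * (θ₁.localComponent (w : HeightOneSpectrum (𝓞 L))) ^ (1 - ((2 : ℕ) : ℤ)))))) := by
    rcases hθw with h | h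
    · rw [h]
      exact AreIsomorphicRep.refl _
    · rw [h, mul_mul_inv_zpow_one_sub_two, mul_zpow_one_sub_two]
      exact (Zelevinsky1980.areIsomorphicRep_parabolicIndGL_two_swap (θ₁.localComponent (w : HeightOneSpectrum (𝓞 L)))
        (χ' * (θ₁.localComponent (w : HeightOneSpectrum (𝓞 L)))⁻¹) hθ₁wu hθ₁wc
        (norm_mul_inv_apply_eq_one _ _ hθ₁wu hχ'u) (continuous_mul_inv_apply _ _ hθ₁wc hχ'c)).symm
  -- assembly along the frames: `inlᵢ k = e_w^{VWᵢ,-1} (reindexGL e (e_w^V k ⊗ 1))`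
  have hk₁ : ∀ k, UnitaryGroup.localLineInl L (IsCMField.complexConj L) 2 e (Matrix.diagonal dV) (JW (Fp L) L a₁) v k =
      (UnitaryGroup.localPiSplitEquiv (IsCMField.complexConj L) (Matrix.reindex e e ((Matrix.diagonal dV) ⊗ₖ JW (Fp L) L a₁)) hc1 hJh₁ w hw hJw₁).symm.toMonoidHom
        (UnitaryGroup.reindexGL e (kroneckerGL (UnitaryGroup.localPiSplitEquiv (IsCMField.complexConj L) (Matrix.diagonal dV) hc1 hJVh w hw hJVw k, 1))) := by
    intro k
    have h := UnitaryGroup.localLineInl_localPiSplitEquiv_symm_apply L (IsCMField.complexConj L) 2 e (Matrix.diagonal dV) (JW (Fp L) L a₁) hc1 hJVh hJh₁ w hw hJVw hJw₁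
      (UnitaryGroup.localPiSplitEquiv (IsCMField.complexConj L) (Matrix.diagonal dV) hc1 hJVh w hw hJVw k)
    rwa [ContinuousMulEquiv.symm_apply_apply] at h
  have hk₂ : ∀ k, UnitaryGroup.localLineInl L (IsCMField.complexConj L) 2 e (Matrix.diagonal dV) (JW (Fp L) L a₂) v k =
      (UnitaryGroup.localPiSplitEquiv (IsCMField.complexConj L) (Matrix.reindex e e ((Matrix.diagonal dV) ⊗ₖ JW (Fp L) L a₂)) hc1 hJh₂ w hw hJw₂).symm.toMonoidHom
        (UnitaryGroup.reindexGL e (kroneckerGL (UnitaryGroup.localPiSplitEquiv (IsCMField.complexConj L) (Matrix.diagonal dV) hc1 hJVh w hw hJVw k, 1))) := by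
    intro k
    have h := UnitaryGroup.localLineInl_localPiSplitEquiv_symm_apply L (IsCMField.complexConj L) 2 e (Matrix.diagonal dV) (JW (Fp L) L a₂) hc1 hJVh hJh₂ w hw hJVw hJw₂
      (UnitaryGroup.localPiSplitEquiv (IsCMField.complexConj L) (Matrix.diagonal dV) hc1 hJVh w hw hJVw k)
    rwa [ContinuousMulEquiv.symm_apply_apply] at h
  exact areIsomorphicRep_comp_of_frames _ _ _ _ _ hk₁ hk₂ N₁ N₂ hPS

end Literature.NumberTheory.Automorphic.Liu2021.Def411WeilCarriers

end
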